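import Summits.QuantumFields.YangMills.Theorems.LuscherReductionTwistedTraceScalingBOAssemblyPrelim
import Summits.QuantumFields.YangMills.Theorems.LuscherReductionTwistedTraceScalingGaugeSlice
import HarnessLib

/-!
# The tube form and the bilinear tube form are blind to the FULL gauge average in each slot
# (lane A of S-BASE, crux `TwistedTraceScaling` stmt-QuantumFields-20203, C4 INNER; design note `pub/ym-fleet/ym-luscher-20007-p1/COARSE-DESIGN.md` §24.11 — tools for the (ST)/(OD) pens)

The gauge-averaged kernel `K̃_β` is bi-invariant under ALL gauge transformations (`avgKernel_gaugeTransform_left/right`) and averaging is self-adjoint against invariants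
(`integral_gaugeAvg_mul_invariant`), so `X(f, gaugeAvg g) = X(f, g) = X(gaugeAvg f, g)` and `T(gaugeAvg f) = T(f)`: in the STIFF and OFFDIAG bricks only the gauge-invariant parts
of `v` and of the BO function are seen by the forms (the weighted norms are NOT invariant — `w = N/χ` — which is where the gauge-mode stiffness comes from).
* ★ `tubeCross_gaugeAvg_right`, ★ `tubeCross_gaugeAvg_left`, ★★ `tubeForm_gaugeAvg`.
HONEST FRAMING: bookkeeping for a stub of a child of the CONDITIONAL reduction route R2b1; analytic bricks OPEN; C4 OPEN; not a gap, not Clay.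
-/

set_option autoImplicit false

noncomputable section

open MeasureTheory Filter Topology Real
open scoped BigOperators
open Literature.MathematicalPhysics.QuantumFieldTheory
open Literature.MathematicalPhysics.QuantumLattice

namespace Summit.QuantumFields.YangMills.Theorems.FemtoTransferGap.TwoLattice.ConstTube

open Summit.QuantumFields.YangMills.Theorems.FemtoTransferGap
open Summit.QuantumFields.YangMills.Theorems.FemtoTransferGap.TwoLattice.Avg

variable {L : ℕ} [NeZero L]

/-- ★ `X(f, gaugeAvg g) = X(f, g)` for bounded measurable `f, g`. [cite: SeilerLNP1982, §3] -/
theorem tubeCross_gaugeAvg_right (β : ℝ) (f : GaugeConfig 3 L SU2 → ℝ) {g : GaugeConfig 3 L SU2 → ℝ} (hg : Measurable g) {Cg : ℝ}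
    (hCg : ∀ U, |g U| ≤ Cg) : tubeCross β f (gaugeAvg g) = tubeCross β f g := by
  obtain ⟨M, hM0, hM⟩ := exists_avgKernel_le (L := L) β
  rw [tubeCross_eq_integral_mul, tubeCross_eq_integral_mul]
  refine integral_congr_ae (ae_of_all _ fun U => ?_)
  dsimp only
  congr 1
  have hKm := measurable_avgKernel_right β U
  have hKb : ∀ V, |avgKernel β U V| ≤ M := fun V => by rw [abs_of_pos (avgKernel_pos β U V)]; exact hM U V
  have hKinv : ∀ (h : Site 3 L → SU2) (V : GaugeConfig 3 L SU2), avgKernel β U (gaugeTransform h V) = avgKernel β U V := fun h V => avgKernel_gaugeTransform_right β h U V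
  have h1 := integral_gaugeAvg_mul_invariant hg hCg hKm hKb hKinv
  calc ∫ V, avgKernel β U V * gaugeAvg g V ∂configMeasure SU2 L = ∫ V, gaugeAvg g V * avgKernel β U V ∂configMeasure SU2 L :=
        integral_congr_ae (ae_of_all _ fun V => mul_comm _ _)
    _ = ∫ V, g V * avgKernel β U V ∂configMeasure SU2 L := h1
    _ = ∫ V, avgKernel β U V * g V ∂configMeasure SU2 L := integral_congr_ae (ae_of_all _ fun V => mul_comm _ _)

/-- ★ `X(gaugeAvg f, g) = X(f, g)` for bounded measurable `f, g`. [cite: SeilerLNP1982, §3] -/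
theorem tubeCross_gaugeAvg_left (β : ℝ) {f g : GaugeConfig 3 L SU2 → ℝ} (hf : Measurable f) {Cf : ℝ} (hCf : ∀ U, |f U| ≤ Cf) (hg : Measurable g) {Cg : ℝ}
    (hCg : ∀ U, |g U| ≤ Cg) : tubeCross β (gaugeAvg f) g = tubeCross β f g := by
  obtain ⟨hJm, ⟨MJ, hJb⟩, hJinv⟩ := integral_avgKernel_mul_props β hg hCg
  rw [tubeCross_eq_integral_mul, tubeCross_eq_integral_mul]
  exact integral_gaugeAvg_mul_invariant hf hCf hJm hJb hJinv

/-- ★★ **THE TUBE FORM IS BLIND TO THE GAUGE AVERAGE**: `T(gaugeAvg f) = T(f)`. [cite: SeilerLNP1982, §3] -/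
theorem tubeForm_gaugeAvg (β : ℝ) {f : GaugeConfig 3 L SU2 → ℝ} (hf : Measurable f) {Cf : ℝ} (hCf : ∀ U, |f U| ≤ Cf) : tubeForm β (gaugeAvg f) = tubeForm β f := by
  have hAm := measurable_gaugeAvg hf
  have hAb := abs_gaugeAvg_le hf hCf
  rw [← tubeCross_self, tubeCross_gaugeAvg_left β hf hCf hAm hAb, tubeCross_gaugeAvg_right β f hf hCf, tubeCross_self]

/-- In particular the bilinear form of a pair is that of their gauge averages. [folklore] -/
theorem tubeCross_eq_gaugeAvg (β : ℝ) {f g : GaugeConfig 3 L SU2 → ℝ} (hf : Measurable f) {Cf : ℝ} (hCf : ∀ U, |f U| ≤ Cf) (hg : Measurable g) {Cg : ℝ}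
    (hCg : ∀ U, |g U| ≤ Cg) : tubeCross β f g = tubeCross β (gaugeAvg f) (gaugeAvg g) := by
  rw [tubeCross_gaugeAvg_left β hf hCf (measurable_gaugeAvg hg) (abs_gaugeAvg_le hg hCg), tubeCross_gaugeAvg_right β f hg hCg]

end Summit.QuantumFields.YangMills.Theorems.FemtoTransferGap.TwoLattice.ConstTube

end
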